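import Summits.KontsevichZagierPeriods.KontsevichZagierPeriods.Theses.HurwitzMicroSectors
import Summits.KontsevichZagierPeriods.KontsevichZagierPeriods.Theorems.HurwitzMicroSectorsNormalFormPrinciplePiBoxTransfer

/-! TTRL-lite variant V2239 of stmt-KontsevichZagierPeriods-3869

Variant V2239 = `stub_boxRigidity` (BoxRigidity: two box-rational representations — domain the open
unit box, integrand `p/q` over `ℚ` — with equal values are KZ-equivalent) under the JOINT bound
`bound_nat:m≤3; bound_nat:m'≤2`. Verdict of the attempt seat: **open** — this file is the exact-strength
certificate, not a proof of the variant. Unlike a one-sided bound (which is the whole leaf,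
`boxRigidityLeftLe_iff` / `boxRigidityRightLe_iff`, file `…Variants2256`), a joint bound `m ≤ j, m' ≤ k`
pins the variant to ONE dimension: it is equivalent to BoxVanishing in dimension `max j k` (every
box-rational representation on `(0,1)^{max j k}` of value `0` is a relation), i.e. to Conjecture 1 for
box-rational periods of that single dimension (`boxRigidityLe_iff_boxVanishing`): pad both
representations to the common box by unit intervals (`pad_le`, Newton–Leibniz + null faces) and
subtract the integrands (`sub_same`) one way; compare with the zero representation on the `0`-box the
other way. For V2239 the dimension is `3` (`stub_boxRigidity_var2239_iff_boxVanishing_three`); the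
bound on `m'` is idle (`stub_boxRigidity_var2239_iff_le_three`), and already the dimension-`2`
consequence (`boxVanishing_two_of_stub_boxRigidity_var2239`) governs every `ℚ`-linear relation among
the periods `∫∫_{(0,1)²} p/q` — `1, log 2, π, π², π log 2, log² 2, G = ∫∫ dx dy/(1+x²y²)` (Catalan), `Li₂`
and Clausen values, … — whose arithmetic nature is unknown; no argument in the tree or the literature
proves or refutes it, and `KontsevichZagierPeriods → V2239` (`stub_boxRigidity_var2239_of_statement`), so
a refutation would refute the Summit. (The two-sided instance `m, m' ≤ 1` is the theorem
`boxRigidity_of_le_one`, by Baker; dimension `2` is the first open one.)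
Source: M. Kontsevich, D. Zagier, *Periods* (2001), §1.2 Conjecture 1 and rules 1)–3).
Pure proof file, no definitions. -/

-- `Summit.<Summit>.<Problem>` is the tree's mandated summit-side namespace (CONVENTIONS §2); for this
-- single-conjunct summit the two coincide, so the duplicate is deliberate.
set_option linter.dupNamespace false

noncomputable section

namespace Summit.KontsevichZagierPeriods.KontsevichZagierPeriods.Theorems

open MeasureTheory Set
open Literature.NumberTheory.Transcendental Literature.NumberTheory.Transcendental.KZ
open Summit.KontsevichZagierPeriods.KontsevichZagierPeriods.Theses.HurwitzMicroSectors
open Summit.KontsevichZagierPeriods.HurwitzMicroSectors.NormalFormPrinciple.PiBox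
open Summit.KontsevichZagierPeriods.HurwitzMicroSectors.NormalFormPrinciple.PiBox.stub_boxCombineAux

/-! ## BoxVanishing is monotone in the dimension; a joint bound is one dimension -/

/-- **BoxVanishing descends along padding**: if every box-rational representation of dimension `K`
with value `0` is a relation, so is every box-rational representation of dimension `j ≤ K` with value
`0` (pad it to the `K`-box, `pad_le`; the padded representation has the same value by soundness).
[cite: KontsevichZagier2001, §1.2] -/
theorem boxVanishing_mono {j K : ℕ} (h : j ≤ K)
    (hvan : ∀ N : IntegralRep K, N.domain = {x | ∀ i, x i ∈ Set.Ioo (0:ℝ) 1} → N.IsRational →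
      N.value = 0 → of N ∈ relations)
    (N : IntegralRep j) (hNd : N.domain = {x | ∀ i, x i ∈ Set.Ioo (0:ℝ) 1}) (hNr : N.IsRational)
    (hv : N.value = 0) : of N ∈ relations := by
  obtain ⟨R, hRd, hRr, hR⟩ := pad_le h N hNd hNr
  have hRv : R.value = 0 := by
    have e := relations_le_ker_eval_holds hR
    simp only [AddMonoidHom.mem_ker, map_sub, eval_of] at e
    linarith
  have := relations.add_mem hR (hvan R hRd hRr hRv)
  rwa [sub_add_cancel] at this

/-- **BoxVanishing in a dimension `K ≥ j, k` gives BoxRigidity under the joint bound `m ≤ j`,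
`m' ≤ k`**: pad both representations to the `K`-box (`pad_le`), subtract the integrands on the common
box (`sub_same`, rule 1b)); the difference representation has value `0` by soundness, hence is a
relation. [cite: KontsevichZagier2001, §1.2] -/
theorem boxRigidityLe_of_boxVanishing {j k K : ℕ} (hj : j ≤ K) (hk : k ≤ K)
    (hvan : ∀ N : IntegralRep K, N.domain = {x | ∀ i, x i ∈ Set.Ioo (0:ℝ) 1} → N.IsRational →
      N.value = 0 → of N ∈ relations) :
    ∀ (m m' : ℕ) (N : IntegralRep m) (N' : IntegralRep m'), m' ≤ k → m ≤ j →
      N.domain = {x | ∀ i, x i ∈ Set.Ioo (0:ℝ) 1} → N.IsRational →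
      N'.domain = {x | ∀ i, x i ∈ Set.Ioo (0:ℝ) 1} → N'.IsRational →
      N.value = N'.value → Equivalent N N' := by
  intro m m' N N' hm' hm hNd hNr hN'd hN'r hv
  obtain ⟨R₁, h₁d, h₁r, h₁⟩ := pad_le (hm.trans hj) N hNd hNr
  obtain ⟨R₂, h₂d, h₂r, h₂⟩ := pad_le (hm'.trans hk) N' hN'd hN'r
  obtain ⟨M, hMd, hMr, hM⟩ := sub_same R₁ R₂ h₁d h₁r h₂d h₂r
  have hMv : M.value = 0 := by
    have e₁ := relations_le_ker_eval_holds h₁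
    have e₂ := relations_le_ker_eval_holds h₂
    have e := relations_le_ker_eval_holds hM
    simp only [AddMonoidHom.mem_ker, map_sub, eval_of] at e₁ e₂ e
    linarith
  have e : of N - of N' = (of N - of R₁) - (of N' - of R₂) + (of R₁ - of R₂ - of M) + of M := by abel
  show of N - of N' ∈ relations
  rw [e]
  exact relations.add_mem (relations.add_mem (relations.sub_mem h₁ h₂) hM) (hvan M hMd hMr hMv)

/-- **Conversely, BoxRigidity under a joint bound `m ≤ j`, `m' ≤ k` gives BoxVanishing in every
dimension `K ≤ j`**: compare a box-rational representation of value `0` with the zero representation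
on the `0`-box (box-rational, value `0`, itself a relation; `0 ≤ k` always).
[cite: KontsevichZagier2001, §1.2 Conjecture 1] -/
theorem boxVanishing_of_boxRigidityLe {j k K : ℕ} (hj : K ≤ j)
    (hrig : ∀ (m m' : ℕ) (N : IntegralRep m) (N' : IntegralRep m'), m' ≤ k → m ≤ j →
      N.domain = {x | ∀ i, x i ∈ Set.Ioo (0:ℝ) 1} → N.IsRational →
      N'.domain = {x | ∀ i, x i ∈ Set.Ioo (0:ℝ) 1} → N'.IsRational →
      N.value = N'.value → Equivalent N N')
    (N : IntegralRep K) (hNd : N.domain = {x | ∀ i, x i ∈ Set.Ioo (0:ℝ) 1}) (hNr : N.IsRational)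
    (hv : N.value = 0) : of N ∈ relations := by
  obtain ⟨Z, hZd, hZi⟩ := exists_zeroRep (isSemialgebraic_box 0)
  have hZ : of Z ∈ relations := of_mem_relations_of_eqOn_zero Z (by simp [hZi, EqOn])
  have hZv : Z.value = 0 := by simp [IntegralRep.value, hZi]
  have hZr : Z.IsRational := ⟨0, 1, fun x _ => by simp, fun x _ => by simp [hZi]⟩
  have h : of N - of Z ∈ relations :=
    hrig K 0 N Z (Nat.zero_le k) hj hNd hNr hZd hZr (by rw [hv, hZv])
  simpa using relations.add_mem h hZ

/-- **A joint bound is one dimension: `BoxRigidity (m ≤ j, m' ≤ k) ⟺ BoxVanishing (max j k)`.**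
So the programmatic move `bound_nat:m≤j; bound_nat:m'≤k` of `stub_boxRigidity` produces exactly
Conjecture 1 for box-rational periods of dimension `max j k` — a theorem for `max j k ≤ 1`
(`boxRigidity_of_le_one`, Baker), open from dimension `2` on. [cite: KontsevichZagier2001, §1.2 Conjecture 1] -/
theorem boxRigidityLe_iff_boxVanishing (j k : ℕ) :
    (∀ (m m' : ℕ) (N : IntegralRep m) (N' : IntegralRep m'), m' ≤ k → m ≤ j →
      N.domain = {x | ∀ i, x i ∈ Set.Ioo (0:ℝ) 1} → N.IsRational →
      N'.domain = {x | ∀ i, x i ∈ Set.Ioo (0:ℝ) 1} → N'.IsRational →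
      N.value = N'.value → Equivalent N N') ↔
    (∀ N : IntegralRep (max j k), N.domain = {x | ∀ i, x i ∈ Set.Ioo (0:ℝ) 1} → N.IsRational →
      N.value = 0 → of N ∈ relations) := by
  refine ⟨fun h N hNd hNr hv => ?_,
    fun h => boxRigidityLe_of_boxVanishing (le_max_left j k) (le_max_right j k) h⟩
  rcases le_total k j with hkj | hjk
  · -- `max j k = j`: BoxVanishing `j` from the bound on `m`, then descend to `max j k`
    exact boxVanishing_mono (max_le le_rfl hkj) (boxVanishing_of_boxRigidityLe le_rfl h) N hNd hNr hv
  · -- `max j k = k`: `Equivalent` is symmetric, so the bounds may be read on either side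
    have h' : ∀ (m m' : ℕ) (N : IntegralRep m) (N' : IntegralRep m'), m' ≤ j → m ≤ k →
        N.domain = {x | ∀ i, x i ∈ Set.Ioo (0:ℝ) 1} → N.IsRational →
        N'.domain = {x | ∀ i, x i ∈ Set.Ioo (0:ℝ) 1} → N'.IsRational →
        N.value = N'.value → Equivalent N N' :=
      fun m m' N N' hm' hm hNd hNr hN'd hN'r hv =>
        (h m' m N' N hm hm' hN'd hN'r hNd hNr hv.symm).symm
    exact boxVanishing_mono (max_le hjk le_rfl) (boxVanishing_of_boxRigidityLe le_rfl h') N hNd hNr hv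

/-! ## The variant V2239 itself: Conjecture 1 for box-rational periods of dimension 3 -/

/-- **V2239 ⟺ BoxVanishing in dimension `3`** (every box-rational representation on `(0,1)³` of value
`0` is a relation). [cite: KontsevichZagier2001, §1.2 Conjecture 1] -/
theorem stub_boxRigidity_var2239_iff_boxVanishing_three :
    (∀ (m m' : ℕ) (N : IntegralRep m) (N' : IntegralRep m'), m' ≤ 2 → m ≤ 3 → N.domain = {x | ∀ i, x i ∈ Set.Ioo (0:ℝ) 1} → N.IsRational → N'.domain = {x | ∀ i, x i ∈ Set.Ioo (0:ℝ) 1} → N'.IsRational → N.value = N'.value → Equivalent N N') ↔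
    (∀ N : IntegralRep 3, N.domain = {x | ∀ i, x i ∈ Set.Ioo (0:ℝ) 1} → N.IsRational →
      N.value = 0 → of N ∈ relations) :=
  ⟨fun h => boxVanishing_of_boxRigidityLe le_rfl h,
    fun h => boxRigidityLe_of_boxVanishing le_rfl (by norm_num) h⟩

/-- **The bound on `m'` is idle: V2239 ⟺ BoxRigidity with `m, m' ≤ 3`** (both sides are BoxVanishing
in dimension `3`). [cite: KontsevichZagier2001, §1.2 Conjecture 1] -/
theorem stub_boxRigidity_var2239_iff_le_three :
    (∀ (m m' : ℕ) (N : IntegralRep m) (N' : IntegralRep m'), m' ≤ 2 → m ≤ 3 → N.domain = {x | ∀ i, x i ∈ Set.Ioo (0:ℝ) 1} → N.IsRational → N'.domain = {x | ∀ i, x i ∈ Set.Ioo (0:ℝ) 1} → N'.IsRational → N.value = N'.value → Equivalent N N') ↔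
    (∀ (m m' : ℕ) (N : IntegralRep m) (N' : IntegralRep m'), m' ≤ 3 → m ≤ 3 →
      N.domain = {x | ∀ i, x i ∈ Set.Ioo (0:ℝ) 1} → N.IsRational →
      N'.domain = {x | ∀ i, x i ∈ Set.Ioo (0:ℝ) 1} → N'.IsRational →
      N.value = N'.value → Equivalent N N') :=
  ⟨fun h => boxRigidityLe_of_boxVanishing le_rfl le_rfl (boxVanishing_of_boxRigidityLe le_rfl h),
    fun h => boxRigidityLe_of_boxVanishing le_rfl (by norm_num) (boxVanishing_of_boxRigidityLe le_rfl h)⟩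

/-- **V2239 ⇒ BoxVanishing in dimension `2`**: the variant already decides every `ℚ`-linear relation
among the box periods `∫∫_{(0,1)²} p/q` (`π log 2`, `log² 2`, Catalan's `G`, `Li₂` and Clausen values …)
in favour of the calculus — the first dimension where this is open. [cite: KontsevichZagier2001, §1.2 Conjecture 1] -/
theorem boxVanishing_two_of_stub_boxRigidity_var2239
    (h : ∀ (m m' : ℕ) (N : IntegralRep m) (N' : IntegralRep m'), m' ≤ 2 → m ≤ 3 → N.domain = {x | ∀ i, x i ∈ Set.Ioo (0:ℝ) 1} → N.IsRational → N'.domain = {x | ∀ i, x i ∈ Set.Ioo (0:ℝ) 1} → N'.IsRational → N.value = N'.value → Equivalent N N')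
    (N : IntegralRep 2) (hNd : N.domain = {x | ∀ i, x i ∈ Set.Ioo (0:ℝ) 1}) (hNr : N.IsRational)
    (hv : N.value = 0) : of N ∈ relations :=
  boxVanishing_mono (by norm_num) (stub_boxRigidity_var2239_iff_boxVanishing_three.1 h) N hNd hNr hv

/-- **`KontsevichZagierPeriods ⇒ V2239`**: the variant is a special case of Conjecture 1 for the
tree's calculus — so a refutation of the variant would refute the Summit.
[cite: KontsevichZagier2001, §1.2 Conjecture 1] -/
theorem stub_boxRigidity_var2239_of_statement (h : _root_.KontsevichZagierPeriods) :
    ∀ (m m' : ℕ) (N : IntegralRep m) (N' : IntegralRep m'), m' ≤ 2 → m ≤ 3 → N.domain = {x | ∀ i, x i ∈ Set.Ioo (0:ℝ) 1} → N.IsRational → N'.domain = {x | ∀ i, x i ∈ Set.Ioo (0:ℝ) 1} → N'.IsRational → N.value = N'.value → Equivalent N N' :=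
  fun m m' N N' _ _ => (leaves_of_statement h).1 m m' N N'

/-- **The parent leaf ⇒ V2239** (the variant is a specialisation of `stub_boxRigidity`; the converse
is not claimed — the parent is BoxVanishing in ALL dimensions). [cite: KontsevichZagier2001, §1.2 Conjecture 1] -/
theorem stub_boxRigidity_var2239_of_parent
    (h : ∀ (m m' : ℕ) (N : IntegralRep m) (N' : IntegralRep m'), N.domain = {x | ∀ i, x i ∈ Set.Ioo (0:ℝ) 1} → N.IsRational → N'.domain = {x | ∀ i, x i ∈ Set.Ioo (0:ℝ) 1} → N'.IsRational → N.value = N'.value → Equivalent N N') :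
    ∀ (m m' : ℕ) (N : IntegralRep m) (N' : IntegralRep m'), m' ≤ 2 → m ≤ 3 → N.domain = {x | ∀ i, x i ∈ Set.Ioo (0:ℝ) 1} → N.IsRational → N'.domain = {x | ∀ i, x i ∈ Set.Ioo (0:ℝ) 1} → N'.IsRational → N.value = N'.value → Equivalent N N' :=
  fun m m' N N' _ _ => h m m' N N'

end Summit.KontsevichZagierPeriods.KontsevichZagierPeriods.Theorems
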